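import Summits.BirchSwinnertonDyer.BirchSwinnertonDyer.Theorems.ThetaPartnerAtTwoSignedTransportAtTwoFrobeniusTwoTorsion
import Summits.BirchSwinnertonDyer.BirchSwinnertonDyer.Theorems.ThetaPartnerAtTwoSignedTransportAtTwoOrientedEulerFactor
import Summits.BirchSwinnertonDyer.BirchSwinnertonDyer.Theorems.ThetaPartnerAtTwoMazurTateCongruenceAtTwoRIntegrality
import Summits.BirchSwinnertonDyer.Rank1Residual.Supersingular.MazurTateReduction
import HarnessLib

/-!
# Crux `MazurTateCongruenceAtTwoTop` (stmt-BirchSwinnertonDyer-25797) = `MazurTateCongruenceAtTwoR` (21416): the residual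
# isomorphism `W[2] ≃ A[2]` makes the depleting EULER FACTORS at common good odd places CONGRUENT mod `2`, so the
# period-free congruence (V2♭) does not depend on the admissible `S₀` (route-independent core, part 3)

Cell `bsd-wall`, seat `bsd-wall-tp2-p1-w2` (WIDTH seat on the K1 row). THEOREMS ONLY (no `def`, no named fact, no `sorry`);
no route file is imported.

THE POINT. In the crux the ONLY link between the theta partners `W` and `A` is the Galois-equivariant isomorphism
`e : W[2] ≃+ A[2]` (binder `he`); the normal form of `…NormalForm` reduces the crux to the congruence (V2♭)
`L♭_W · E^ι_{S₀}(W) ≡ u · L♭_A · E^ι_{S₀}(A) (mod 2Λ)` for EVERY admissible `S₀` (odd places containing the bad places of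
both curves). Here we prove the first analytic consequence of `he` (Greenberg–Vatsal 2000 §3, the choice of `Σ₀`):

* `zmod_two_frobeniusTraceAt_eq_of_equivariant` — at an odd place `v` good for BOTH curves, `a_v(W) ≡ a_v(A) (mod 2)`:
  a local Frobenius has trace `a_v mod 2` on the `𝔽₂`-plane `E[2]` (tree `trace_det_frob_twoTorsion`, DDT 2.11 (a)), and
  `e` conjugates the two planes (trace is conjugation-invariant, `LinearMap.trace_comp_comm'`);
* hence `eulerFactorModP W 2 v = eulerFactorModP A 2 v` (`P̃_v = 1 − ã_v X + X²`), the oriented Euler-factor elements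
  `𝒫_v^ι = eulerFactorElementInv · 2 v` have the SAME reduction mod `2` (`map_toZMod_eulerFactorElementInv`, lead g3), and
  for a finite set `T` of such places `E^ι_T(W) − E^ι_T(A) ∈ 2Λ` (`exists_eulerFactorProductInv_sub_eq_C_two_mul`);
* `flat_congruence_iff_of_subset` — for admissible `S₁ ⊆ S₀` (so `S₀ ∖ S₁` consists of odd places good for both),
  (V2♭) at `S₀` ⟺ (V2♭) at `S₁`, for ANY `L, L_A ∈ Λ` (the extra factor `E^ι_{S₀∖S₁}(A) ≢ 0 (mod 2)`,
  `eulerFactorProductInv_two_ne_zero_mu_lam`, cancels in the domain `𝔽₂⟦T⟧`); and `flat_congruence_iff_of_admissible` —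
  ANY two admissible sets give equivalent congruences (through `S₀ ∩ S₀'`). So the «S₀-depleted Euler factors can cost a
  factor 2» hazard of item 25797's why-might-fail is confined to the places that are bad for one of the two curves, exactly
  as in Greenberg–Vatsal's choice of `Σ₀`; the good places cost nothing.

References: R. Greenberg, V. Vatsal, Invent. Math. 142 (2000) §1 (8)–(9), §2 Prop. (2.4), §3 [GreenbergVatsal2000];
H. Darmon, F. Diamond, R. Taylor, *Fermat's Last Theorem*, Prop. 2.11 (a) [DarmonDiamondTaylor1995].
-/

set_option autoImplicit false
-- D-0017: single-problem summit, so `Summit.BirchSwinnertonDyer.BirchSwinnertonDyer.…` repeats a namespace BY DESIGN.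
set_option linter.dupNamespace false

noncomputable section

open scoped Classical
open Function Polynomial NumberField IsDedekindDomain Field Rat.HeightOneSpectrum WeierstrassCurve
open Literature.NumberTheory.GaloisRepresentations Literature.NumberTheory.EllipticCurves
  Literature.NumberTheory.EllipticCurves.GreenbergVatsal2000
  Summit.BirchSwinnertonDyer.Rank1Residual.X1.MuLambda
  Summit.BirchSwinnertonDyer.Rank1Residual.X2.EulerFactorInvariants
  Summit.BirchSwinnertonDyer.Rank1Residual.Supersingular
  Summit.BirchSwinnertonDyer.BirchSwinnertonDyer.Theorems.ResidualThetaLayer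
  Summit.BirchSwinnertonDyer.BirchSwinnertonDyer.Theorems.SignedTransportAtTwo

namespace Summit.BirchSwinnertonDyer.BirchSwinnertonDyer.Theorems.MazurTateCongruenceAtTwoR

/-! ## §1. `a_v(W) ≡ a_v(A) (mod 2)` at a common good odd place -/

section Trace

variable (W : WeierstrassCurve ℚ) [W.IsElliptic] [W.IsGloballyMinimal]
  (A : WeierstrassCurve ℚ) [A.IsElliptic] [A.IsGloballyMinimal] (v : HeightOneSpectrum (𝓞 ℚ))

/-- **Residually isomorphic curves have congruent traces mod `2` at common good odd places.** If
`e : W[2] ≃+ A[2]` commutes with `Γ_ℚ` and `v` is an odd place of good reduction for both curves, then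
`a_v(W) ≡ a_v(A) (mod 2)`: the trace of a local Frobenius on the `𝔽₂`-plane `E[2]` is `a_v mod 2`
(`trace_det_frob_twoTorsion`) and is invariant under the conjugation by `e`.
[cite: DarmonDiamondTaylor1995, Prop. 2.11 (a)] [cite: GreenbergVatsal2000, §3 (choice of Σ₀)] -/
theorem zmod_two_frobeniusTraceAt_eq_of_equivariant (hv2 : ((2 : ℕ) : 𝓞 ℚ) ∉ v.asIdeal)
    (hW : W.HasGoodReductionAt v) (hA : A.HasGoodReductionAt v)
    (e : geomTorsion W (2 : ℤ) ≃+ geomTorsion A (2 : ℤ))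
    (he : ∀ (σ : Field.absoluteGaloisGroup ℚ) (P : geomTorsion W (2 : ℤ)), e (σ • P) = σ • e P) :
    (W.frobeniusTraceAt v : ZMod 2) = (A.frobeniusTraceAt v : ZMod 2) := by
  letI : Module (ZMod 2) (geomTorsion W ((2 : ℕ) : ℤ)) := AddSubgroup.torsionBy.zmodModule
  letI : Module (ZMod 2) (geomTorsion A ((2 : ℕ) : ℤ)) := AddSubgroup.torsionBy.zmodModule
  haveI : Fact (Nat.Prime 2) := ⟨Nat.prime_two⟩
  haveI : Finite (geomTorsion W ((2 : ℕ) : ℤ)) :=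
    finite_torsionPoints_holds W (AlgebraicClosure ℚ) (n := ((2 : ℕ) : ℤ)) (by norm_num)
  haveI : Finite (geomTorsion A ((2 : ℕ) : ℤ)) :=
    finite_torsionPoints_holds A (AlgebraicClosure ℚ) (n := ((2 : ℕ) : ℤ)) (by norm_num)
  haveI : Module.Finite (ZMod 2) (geomTorsion W ((2 : ℕ) : ℤ)) := Module.Finite.of_finite
  haveI : Module.Finite (ZMod 2) (geomTorsion A ((2 : ℕ) : ℤ)) := Module.Finite.of_finite
  obtain ⟨φ, hφ⟩ := exists_isFrobPow_holds (F := v.adicCompletion ℚ) 1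
  obtain ⟨htrW, -⟩ := trace_det_frob_twoTorsion W v hv2 hW hφ
  obtain ⟨htrA, -⟩ := trace_det_frob_twoTorsion A v hv2 hA hφ
  rw [← htrW, ← htrA]
  set σ := absGaloisRestrict ℚ (v.adicCompletion ℚ) φ with hσ
  set MW := (galoisRepTorsion W ((2 : ℕ) : ℤ) σ).toAdd.toAddMonoidHom.toZModLinearMap 2 with hMW
  set MA := (galoisRepTorsion A ((2 : ℕ) : ℤ) σ).toAdd.toAddMonoidHom.toZModLinearMap 2 with hMA
  -- `e` and `e⁻¹` as `𝔽₂`-linear maps between the two planes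
  let eW : geomTorsion W ((2 : ℕ) : ℤ) →+ geomTorsion A ((2 : ℕ) : ℤ) := e.toAddMonoidHom
  let eA : geomTorsion A ((2 : ℕ) : ℤ) →+ geomTorsion W ((2 : ℕ) : ℤ) := e.symm.toAddMonoidHom
  set eL := eW.toZModLinearMap 2 with heL
  set eI := eA.toZModLinearMap 2 with heI
  have hcomm : MA ∘ₗ eL = eL ∘ₗ MW := LinearMap.ext fun P ↦ (he σ P).symm
  have hIL : eI ∘ₗ eL = LinearMap.id := LinearMap.ext fun P ↦ e.symm_apply_apply P
  have hLI : eL ∘ₗ eI = LinearMap.id := LinearMap.ext fun Q ↦ e.apply_symm_apply Q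
  symm
  calc LinearMap.trace (ZMod 2) _ MA
      = LinearMap.trace (ZMod 2) _ (MA ∘ₗ (eL ∘ₗ eI)) := by rw [hLI, LinearMap.comp_id]
    _ = LinearMap.trace (ZMod 2) _ (eL ∘ₗ (MW ∘ₗ eI)) := by
        rw [← LinearMap.comp_assoc, hcomm, LinearMap.comp_assoc]
    _ = LinearMap.trace (ZMod 2) _ ((MW ∘ₗ eI) ∘ₗ eL) := LinearMap.trace_comp_comm' _ _
    _ = LinearMap.trace (ZMod 2) _ MW := by rw [LinearMap.comp_assoc, hIL, LinearMap.comp_id]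

/-- **The mod-`2` Euler factors agree at a common good odd place**: `P̃_v(W) = P̃_v(A)` in `𝔽₂[X]`
(`P̃_v = 1 − ã_v X + ℓ̃ X²` with `ã_v(W) = ã_v(A)`). [cite: GreenbergVatsal2000, §2 Prop. (2.4) (p. 22)] -/
theorem eulerFactorModP_two_eq_of_equivariant (hv2 : ((2 : ℕ) : 𝓞 ℚ) ∉ v.asIdeal)
    (hW : W.HasGoodReductionAt v) (hA : A.HasGoodReductionAt v)
    (e : geomTorsion W (2 : ℤ) ≃+ geomTorsion A (2 : ℤ))
    (he : ∀ (σ : Field.absoluteGaloisGroup ℚ) (P : geomTorsion W (2 : ℤ)), e (σ • P) = σ • e P) :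
    eulerFactorModP W 2 v = eulerFactorModP A 2 v := by
  have h := zmod_two_frobeniusTraceAt_eq_of_equivariant W A v hv2 hW hA e he
  have hW' : (Int.castRingHom (ZMod 2)) (W.frobeniusTraceAt v) = (Int.castRingHom (ZMod 2)) (A.frobeniusTraceAt v) := by
    rw [eq_intCast, eq_intCast, h]
  rw [eulerFactorModP, eulerFactorModP, localPolynomialAt_of_hasGoodReductionAt hW,
    localPolynomialAt_of_hasGoodReductionAt hA]
  simp only [Polynomial.map_add, Polynomial.map_sub, Polynomial.map_mul, Polynomial.map_pow, Polynomial.map_C,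
    Polynomial.map_X, Polynomial.map_one, hW']

/-- **The oriented Euler-factor elements agree mod `2`** at a common good odd place: `𝒫_v^ι(W) ≡ 𝒫_v^ι(A) (mod 2Λ)`,
read as equality of the reductions in `𝔽₂⟦T⟧`. [cite: GreenbergVatsal2000, §2 Prop. (2.4) (p. 22)] -/
theorem map_toZMod_eulerFactorElementInv_eq_of_equivariant (hv2 : ((2 : ℕ) : 𝓞 ℚ) ∉ v.asIdeal)
    (hW : W.HasGoodReductionAt v) (hA : A.HasGoodReductionAt v)
    (e : geomTorsion W (2 : ℤ) ≃+ geomTorsion A (2 : ℤ))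
    (he : ∀ (σ : Field.absoluteGaloisGroup ℚ) (P : geomTorsion W (2 : ℤ)), e (σ • P) = σ • e P) :
    PowerSeries.map (PadicInt.toZMod (p := 2)) (eulerFactorElementInv W 2 v) =
      PowerSeries.map (PadicInt.toZMod (p := 2)) (eulerFactorElementInv A 2 v) := by
  haveI : Fact (Nat.Prime 2) := ⟨Nat.prime_two⟩
  have hℓ : Rat.HeightOneSpectrum.natGenerator v ≠ 2 := natGenerator_ne_of_natCast_not_mem v hv2
  rw [map_toZMod_eulerFactorElementInv W v hℓ, map_toZMod_eulerFactorElementInv A v hℓ,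
    eulerFactorModP_two_eq_of_equivariant W A v hv2 hW hA e he]

end Trace

/-! ## §2. Products over common good odd places -/

section Product

variable (W : WeierstrassCurve ℚ) [W.IsElliptic] [W.IsGloballyMinimal]
  (A : WeierstrassCurve ℚ) [A.IsElliptic] [A.IsGloballyMinimal]

/-- **`E^ι_T(W) ≡ E^ι_T(A) (mod 2Λ)`** for a finite set `T` of odd places good for BOTH curves of a residually isomorphic
pair: the oriented depletion factors differ by an element of `2Λ`. [cite: GreenbergVatsal2000, §1 (8)–(9) and §2 Prop. (2.4)] -/
theorem exists_eulerFactorProductInv_sub_eq_C_two_mul (T : Finset (HeightOneSpectrum (𝓞 ℚ)))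
    (hT2 : ∀ v ∈ T, ((2 : ℕ) : 𝓞 ℚ) ∉ v.asIdeal) (hTW : ∀ v ∈ T, W.HasGoodReductionAt v)
    (hTA : ∀ v ∈ T, A.HasGoodReductionAt v)
    (e : geomTorsion W (2 : ℤ) ≃+ geomTorsion A (2 : ℤ))
    (he : ∀ (σ : Field.absoluteGaloisGroup ℚ) (P : geomTorsion W (2 : ℤ)), e (σ • P) = σ • e P) :
    ∃ d : IwasawaAlgebra 2, eulerFactorProductInv W 2 T - eulerFactorProductInv A 2 T = PowerSeries.C (2 : ℤ_[2]) * d := by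
  haveI : Fact (Nat.Prime 2) := ⟨Nat.prime_two⟩
  have hred : PowerSeries.map (PadicInt.toZMod (p := 2)) (eulerFactorProductInv W 2 T - eulerFactorProductInv A 2 T) = 0 := by
    rw [map_sub, eulerFactorProductInv_eq_prod, eulerFactorProductInv_eq_prod, map_prod, map_prod, sub_eq_zero]
    exact Finset.prod_congr rfl fun v hv ↦
      map_toZMod_eulerFactorElementInv_eq_of_equivariant W A v (hT2 v hv) (hTW v hv) (hTA v hv) e he
  have hdvd : PowerSeries.C ((2 : ℕ) : ℤ_[2]) ∣ eulerFactorProductInv W 2 T - eulerFactorProductInv A 2 T := by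
    rw [← red_eq_zero_iff]
    by_contra hne
    exact map_toZMod_ne_zero_of_red_ne_zero hne hred
  obtain ⟨d, hd⟩ := hdvd
  exact ⟨d, by rw [hd, Nat.cast_ofNat]⟩

omit [A.IsElliptic] [A.IsGloballyMinimal] in
/-- **`E^ι_T(A) ≢ 0 (mod 2)`** for a finite set `T` of odd places: the oriented depletion factor has unit content
(`μ = 0`, `eulerFactorProductInv_two_ne_zero_mu_lam`). [cite: GreenbergVatsal2000, §2 Prop. (2.4)] -/
theorem map_toZMod_eulerFactorProductInv_two_ne_zero (T : Finset (HeightOneSpectrum (𝓞 ℚ)))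
    (hT2 : ∀ v ∈ T, ((2 : ℕ) : 𝓞 ℚ) ∉ v.asIdeal) :
    PowerSeries.map (PadicInt.toZMod (p := 2)) (eulerFactorProductInv A 2 T) ≠ 0 := by
  haveI : Fact (Nat.Prime 2) := ⟨Nat.prime_two⟩
  obtain ⟨hne, hμ, -⟩ := eulerFactorProductInv_two_ne_zero_mu_lam A T hT2
  exact map_toZMod_ne_zero_of_red_ne_zero (red_ne_zero_of_mu_eq_zero hne hμ)

end Product

/-! ## §3. (V2♭) does not depend on the admissible `S₀` -/

section Independence

variable (W : WeierstrassCurve ℚ) [W.IsElliptic] [W.IsGloballyMinimal]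
  (A : WeierstrassCurve ℚ) [A.IsElliptic] [A.IsGloballyMinimal]

/-- **(V2♭) at `S₀` ⟺ (V2♭) at `S₁`, for admissible `S₁ ⊆ S₀`.** If `S₀` consists of odd places, every place of bad
reduction of `W` or of `A` lies in `S₁ ⊆ S₀`, and `W[2] ≃ A[2]` equivariantly, then for ANY `L, L_A ∈ Λ = ℤ₂⟦T⟧`:
`(∃ u q, L·E^ι_{S₀}(W) − u·L_A·E^ι_{S₀}(A) = 2q) ↔ (∃ u q, L·E^ι_{S₁}(W) − u·L_A·E^ι_{S₁}(A) = 2q)` — the common good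
places `S₀ ∖ S₁` contribute congruent unit-content factors, which cancel in the domain `𝔽₂⟦T⟧`.
[cite: GreenbergVatsal2000, §3 (choice of Σ₀) and §2 Prop. (2.4)] -/
theorem flat_congruence_iff_of_subset {S₀ S₁ : Finset (HeightOneSpectrum (𝓞 ℚ))} (hsub : S₁ ⊆ S₀)
    (hS2 : ∀ v ∈ S₀, ((2 : ℕ) : 𝓞 ℚ) ∉ v.asIdeal)
    (hSW : ∀ v : HeightOneSpectrum (𝓞 ℚ), ¬ W.HasGoodReductionAt v → v ∈ S₁)
    (hSA : ∀ v : HeightOneSpectrum (𝓞 ℚ), ¬ A.HasGoodReductionAt v → v ∈ S₁)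
    (e : geomTorsion W (2 : ℤ) ≃+ geomTorsion A (2 : ℤ))
    (he : ∀ (σ : Field.absoluteGaloisGroup ℚ) (P : geomTorsion W (2 : ℤ)), e (σ • P) = σ • e P)
    (L LA : IwasawaAlgebra 2) :
    (∃ (u : ℤ_[2]ˣ) (q : IwasawaAlgebra 2),
        L * eulerFactorProductInv W 2 S₀ - PowerSeries.C (u : ℤ_[2]) * LA * eulerFactorProductInv A 2 S₀ =
          PowerSeries.C (2 : ℤ_[2]) * q) ↔
      (∃ (u : ℤ_[2]ˣ) (q : IwasawaAlgebra 2),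
        L * eulerFactorProductInv W 2 S₁ - PowerSeries.C (u : ℤ_[2]) * LA * eulerFactorProductInv A 2 S₁ =
          PowerSeries.C (2 : ℤ_[2]) * q) := by
  haveI : Fact (Nat.Prime 2) := ⟨Nat.prime_two⟩
  -- the common good part `S₀ \ S₁`
  have hT2 : ∀ v ∈ S₀ \ S₁, ((2 : ℕ) : 𝓞 ℚ) ∉ v.asIdeal := fun v hv ↦ hS2 v (Finset.mem_sdiff.mp hv).1
  have hTW : ∀ v ∈ S₀ \ S₁, W.HasGoodReductionAt v := fun v hv ↦ by
    by_contra h; exact (Finset.mem_sdiff.mp hv).2 (hSW v h)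
  have hTA : ∀ v ∈ S₀ \ S₁, A.HasGoodReductionAt v := fun v hv ↦ by
    by_contra h; exact (Finset.mem_sdiff.mp hv).2 (hSA v h)
  have hEW : eulerFactorProductInv W 2 S₀ = eulerFactorProductInv W 2 (S₀ \ S₁) * eulerFactorProductInv W 2 S₁ := by
    rw [eulerFactorProductInv_eq_prod, eulerFactorProductInv_eq_prod, eulerFactorProductInv_eq_prod,
      Finset.prod_sdiff hsub]
  have hEA : eulerFactorProductInv A 2 S₀ = eulerFactorProductInv A 2 (S₀ \ S₁) * eulerFactorProductInv A 2 S₁ := by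
    rw [eulerFactorProductInv_eq_prod, eulerFactorProductInv_eq_prod, eulerFactorProductInv_eq_prod,
      Finset.prod_sdiff hsub]
  obtain ⟨d, hd⟩ := exists_eulerFactorProductInv_sub_eq_C_two_mul W A (S₀ \ S₁) hT2 hTW hTA e he
  have hFAbar : PowerSeries.map (PadicInt.toZMod (p := 2)) (eulerFactorProductInv A 2 (S₀ \ S₁)) ≠ 0 :=
    map_toZMod_eulerFactorProductInv_two_ne_zero A (S₀ \ S₁) hT2
  have hC2 : PowerSeries.map (PadicInt.toZMod (p := 2)) (PowerSeries.C (2 : ℤ_[2])) = 0 := by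
    rw [PowerSeries.map_C, show PadicInt.toZMod (p := 2) (2 : ℤ_[2]) = 0 from by
      rw [show (2 : ℤ_[2]) = ((2 : ℕ) : ℤ_[2]) from rfl, map_natCast, ZMod.natCast_self], map_zero]
  have hFbar : PowerSeries.map (PadicInt.toZMod (p := 2)) (eulerFactorProductInv W 2 (S₀ \ S₁)) =
      PowerSeries.map (PadicInt.toZMod (p := 2)) (eulerFactorProductInv A 2 (S₀ \ S₁)) := by
    have h := congr_arg (PowerSeries.map (PadicInt.toZMod (p := 2))) hd
    rw [map_sub, map_mul, hC2, zero_mul, sub_eq_zero] at h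
    exact h
  rw [hEW, hEA]
  constructor
  · rintro ⟨u, q, hq⟩
    -- `F · X = 2 · (q − u L_A E_A(S₁) d)` with `X = L E(S₁) − u L_A E_A(S₁)`, then cancel `F̄ ≠ 0`
    have hFX : eulerFactorProductInv W 2 (S₀ \ S₁) *
        (L * eulerFactorProductInv W 2 S₁ - PowerSeries.C (u : ℤ_[2]) * LA * eulerFactorProductInv A 2 S₁) =
        PowerSeries.C (2 : ℤ_[2]) * (q - PowerSeries.C (u : ℤ_[2]) * LA * eulerFactorProductInv A 2 S₁ * d) := by
      linear_combination hq - (PowerSeries.C (u : ℤ_[2]) * LA * eulerFactorProductInv A 2 S₁) * hd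
    have hXbar : PowerSeries.map (PadicInt.toZMod (p := 2))
        (L * eulerFactorProductInv W 2 S₁ - PowerSeries.C (u : ℤ_[2]) * LA * eulerFactorProductInv A 2 S₁) = 0 := by
      have h := congr_arg (PowerSeries.map (PadicInt.toZMod (p := 2))) hFX
      rw [map_mul, map_mul, hC2, zero_mul, hFbar, mul_eq_zero] at h
      exact h.resolve_left hFAbar
    have hdvd : PowerSeries.C ((2 : ℕ) : ℤ_[2]) ∣
        L * eulerFactorProductInv W 2 S₁ - PowerSeries.C (u : ℤ_[2]) * LA * eulerFactorProductInv A 2 S₁ := by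
      rw [← red_eq_zero_iff]
      by_contra hne
      exact map_toZMod_ne_zero_of_red_ne_zero hne hXbar
    obtain ⟨q', hq'⟩ := hdvd
    exact ⟨u, q', by rw [hq', Nat.cast_ofNat]⟩
  · rintro ⟨u, q, hq⟩
    exact ⟨u, eulerFactorProductInv W 2 (S₀ \ S₁) * q + PowerSeries.C (u : ℤ_[2]) * LA * eulerFactorProductInv A 2 S₁ * d,
      by linear_combination eulerFactorProductInv W 2 (S₀ \ S₁) * hq +
        (PowerSeries.C (u : ℤ_[2]) * LA * eulerFactorProductInv A 2 S₁) * hd⟩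

/-- **(V2♭) does not depend on the admissible `S₀`.** For two finite sets `S₀, S₀'` of odd places, each containing
every place of bad reduction of `W` and of `A`, and `W[2] ≃ A[2]` equivariantly, the congruences
`L·E^ι_{S₀}(W) ≡ u·L_A·E^ι_{S₀}(A) (mod 2Λ)` (some `u ∈ ℤ₂ˣ`) at `S₀` and at `S₀'` are EQUIVALENT, for any `L, L_A ∈ Λ`
(compare both with `S₀ ∩ S₀'`). Greenberg–Vatsal's "the choice of `Σ₀` does not matter" for the signed theory at `2`.
[cite: GreenbergVatsal2000, §3 (choice of Σ₀) and §2 Prop. (2.4)] -/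
theorem flat_congruence_iff_of_admissible {S₀ S₀' : Finset (HeightOneSpectrum (𝓞 ℚ))}
    (hS2 : ∀ v ∈ S₀, ((2 : ℕ) : 𝓞 ℚ) ∉ v.asIdeal)
    (hSW : ∀ v : HeightOneSpectrum (𝓞 ℚ), ¬ W.HasGoodReductionAt v → v ∈ S₀)
    (hSA : ∀ v : HeightOneSpectrum (𝓞 ℚ), ¬ A.HasGoodReductionAt v → v ∈ S₀)
    (hS2' : ∀ v ∈ S₀', ((2 : ℕ) : 𝓞 ℚ) ∉ v.asIdeal)
    (hSW' : ∀ v : HeightOneSpectrum (𝓞 ℚ), ¬ W.HasGoodReductionAt v → v ∈ S₀')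
    (hSA' : ∀ v : HeightOneSpectrum (𝓞 ℚ), ¬ A.HasGoodReductionAt v → v ∈ S₀')
    (e : geomTorsion W (2 : ℤ) ≃+ geomTorsion A (2 : ℤ))
    (he : ∀ (σ : Field.absoluteGaloisGroup ℚ) (P : geomTorsion W (2 : ℤ)), e (σ • P) = σ • e P)
    (L LA : IwasawaAlgebra 2) :
    (∃ (u : ℤ_[2]ˣ) (q : IwasawaAlgebra 2),
        L * eulerFactorProductInv W 2 S₀ - PowerSeries.C (u : ℤ_[2]) * LA * eulerFactorProductInv A 2 S₀ =
          PowerSeries.C (2 : ℤ_[2]) * q) ↔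
      (∃ (u : ℤ_[2]ˣ) (q : IwasawaAlgebra 2),
        L * eulerFactorProductInv W 2 S₀' - PowerSeries.C (u : ℤ_[2]) * LA * eulerFactorProductInv A 2 S₀' =
          PowerSeries.C (2 : ℤ_[2]) * q) := by
  have h1 := flat_congruence_iff_of_subset W A (Finset.inter_subset_left (s₁ := S₀) (s₂ := S₀')) hS2
    (fun v hv ↦ Finset.mem_inter.mpr ⟨hSW v hv, hSW' v hv⟩) (fun v hv ↦ Finset.mem_inter.mpr ⟨hSA v hv, hSA' v hv⟩)
    e he L LA
  have h2 := flat_congruence_iff_of_subset W A (Finset.inter_subset_right (s₁ := S₀) (s₂ := S₀')) hS2'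
    (fun v hv ↦ Finset.mem_inter.mpr ⟨hSW v hv, hSW' v hv⟩) (fun v hv ↦ Finset.mem_inter.mpr ⟨hSA v hv, hSA' v hv⟩)
    e he L LA
  exact h1.trans h2.symm

end Independence

/-! ## §4. The `2`-adic unit is inert modulo `2` (appended by the same seat) -/

section Unit

/-- Every `2`-adic unit is `≡ 1 (mod 2)`: `u = 1 + 2w` in `ℤ₂` (the residue field of `ℤ₂` is `𝔽₂`, whose only unit is `1`).
[folklore] -/
theorem exists_units_eq_one_add_two_mul (u : ℤ_[2]ˣ) : ∃ w : ℤ_[2], (u : ℤ_[2]) = 1 + 2 * w := by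
  have h01 : ∀ a : ZMod 2, a = 0 ∨ a = 1 := by decide
  haveI : Fact (Nat.Prime 2) := ⟨Nat.prime_two⟩
  have hu1 : PadicInt.toZMod (p := 2) (u : ℤ_[2]) = 1 := by
    have hunit : IsUnit (PadicInt.toZMod (p := 2) (u : ℤ_[2])) := (Units.isUnit u).map _
    rcases h01 (PadicInt.toZMod (p := 2) (u : ℤ_[2])) with h | h
    · rw [h] at hunit; exact absurd hunit not_isUnit_zero
    · exact h
  have hmem : (u : ℤ_[2]) - 1 ∈ RingHom.ker (PadicInt.toZMod (p := 2)) := by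
    rw [RingHom.mem_ker, map_sub, hu1, map_one, sub_self]
  rw [PadicInt.ker_toZMod, PadicInt.maximalIdeal_eq_span_p, Ideal.mem_span_singleton] at hmem
  obtain ⟨w, hw⟩ := hmem
  rw [Nat.cast_ofNat] at hw
  exact ⟨w, by linear_combination hw⟩

/-- **The unit is inert in a congruence modulo `2Λ`**: for `X, Y, Z ∈ Λ = ℤ₂⟦T⟧`,
`(∃ u ∈ ℤ₂ˣ, ∃ q, X − u·Y·Z = 2q) ↔ (∃ q, X − Y·Z = 2q)` — since `u ≡ 1 (mod 2)`. In particular the unit `u` of (V2♭),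
and hence of the crux `MazurTateCongruenceAtTwoR` granted the period-unit fact, can be taken to be `1`. [folklore] -/
theorem exists_units_sub_eq_C_two_mul_iff (X Y Z : IwasawaAlgebra 2) :
    (∃ (u : ℤ_[2]ˣ) (q : IwasawaAlgebra 2), X - PowerSeries.C (u : ℤ_[2]) * Y * Z = PowerSeries.C (2 : ℤ_[2]) * q) ↔
      ∃ q : IwasawaAlgebra 2, X - Y * Z = PowerSeries.C (2 : ℤ_[2]) * q := by
  haveI : Fact (Nat.Prime 2) := ⟨Nat.prime_two⟩
  constructor
  · rintro ⟨u, q, hq⟩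
    obtain ⟨w, hw⟩ := exists_units_eq_one_add_two_mul u
    have hCu : (PowerSeries.C (u : ℤ_[2]) : IwasawaAlgebra 2) = 1 + PowerSeries.C (2 : ℤ_[2]) * PowerSeries.C w := by
      rw [hw, map_add, map_one, map_mul]
    exact ⟨q + PowerSeries.C w * Y * Z, by linear_combination hq + (Y * Z) * hCu⟩
  · rintro ⟨q, hq⟩
    exact ⟨1, q, by rw [Units.val_one, map_one, one_mul]; exact hq⟩

end Unit

end Summit.BirchSwinnertonDyer.BirchSwinnertonDyer.Theorems.MazurTateCongruenceAtTwoR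

end
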